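/-
Copyright: H21 programme, solo seat `solo-RiemannHypothesis-informed` (session 5).
-/
import Summits.RiemannHypothesis.RiemannHypothesis.Theorems.SoloInformedUndodgedPhase

/-!
# The un-dodged condition near the pair (solo-informed, T37b)

Continuation of `SoloInformedUndodgedPhase`: the phase lemma `|G(w) − G(η)| ≤ |G(η)|/7` for
`|w − η| ≤ δ₁` (`norm_clusterG_sub_le`) — every linear factor of `−u² C(u)` moves by a relative
`δ₁/η` or `δ₁/δ`, so `−w²C(w) = W·(−η²C(η))` with
`|W − 1| ≤ (1 + δ₁/η)²(1 + δ₁/δ)^{2|S|} − 1 ≤ e^{5/128} − 1 ≤ 5/123` under `256(c+1)δ₁ ≤ η`,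
`64(N+1)δ₁ ≤ δ`, while `|F(w) − F(η)| ≤ (3/64)|F(η)|` — and its consequence, the un-dodged
condition `|ĝ(ρ)|² ≤ ½|ĝ(ρ) − ĝ(1 − ρ̄)|²` of T37a at every `ρ` within `δ₁` of `½ ± η + iγ₀`
(`undodged_condition_near_pair`, T37b).
-/

open MeasureTheory Complex Set Filter Topology Literature.NumberTheory.LFunctions
open scoped ContDiff ComplexConjugate

namespace Summit.RiemannHypothesis.RiemannHypothesis.Theorems

variable {ψ : ℝ → ℝ}

/-! ## The perturbation of `G` -/

set_option maxHeartbeats 400000 in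
/-- **`G` moves little near `η`** (the phase lemma).  With dodged members `δ`-separated from the
pair, `|S| ≤ N`, `256(c+1)δ₁ ≤ η ≤ ½`, `64(N+1)δ₁ ≤ δ` and the gain regime:
`|G(w) − G(η)| ≤ |G(η)|/7` for `|w − η| ≤ δ₁`. -/
theorem norm_clusterG_sub_le (hψ : ContDiff ℝ ∞ ψ) (hsupp : tsupport ψ ⊆ Icc (-1) 1)
    (hψ0 : ∀ s, 0 ≤ ψ s) {η c δ δ₁ γ₀ : ℝ} {N : ℕ} {S : Finset ℂ} (hη : 0 < η)
    (hη2 : η ≤ 1 / 2) (hc : 0 ≤ c)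
    (hreg : 2 * bumpLaplace ψ (-η) ≤ Real.exp (η * c) * bumpLaplace ψ η) (hδ : 0 < δ)
    (hcard : S.card ≤ N)
    (hsep : ∀ ρ ∈ S, δ ≤ ‖ρ - (1 / 2 + η + γ₀ * I)‖ ∧ δ ≤ ‖ρ - (1 / 2 - η + γ₀ * I)‖)
    (hδ₁ : 0 ≤ δ₁) (hδ₁η : 256 * (c + 1) * δ₁ ≤ η) (hδ₁δ : 64 * (N + 1) * δ₁ ≤ δ) {w : ℂ}
    (hw : ‖w - η‖ ≤ δ₁) :
    ‖clusterG ψ c γ₀ S w - clusterG ψ c γ₀ S η‖ ≤ ‖clusterG ψ c γ₀ S (η : ℂ)‖ / 7 := by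
  -- notation
  set F : ℂ → ℂ := fun u ↦ weilMellin (bumpDipole ψ c) (1 / 2 + u) with hF_def
  set Q : ℂ → ℂ := fun u ↦ -u ^ 2 * clusterSym γ₀ S u with hQ_def
  have hG : ∀ u, clusterG ψ c γ₀ S u = Q u * F u := fun u ↦ rfl
  set a : ℂ → ℂ → ℂ := fun u ρ ↦ ρ - (1 / 2 + u + γ₀ * I) with ha_def
  set b : ℂ → ℂ → ℂ := fun u ρ ↦ ρ - (1 / 2 - u + γ₀ * I) with hb_def
  have hQprod : ∀ u, Q u = -u ^ 2 * ((∏ ρ ∈ S, a u ρ) * ∏ ρ ∈ S, b u ρ) := by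
    intro u
    simp only [hQ_def, ha_def, hb_def, clusterSym]
    rw [Finset.prod_mul_distrib]
  -- non-vanishing at `η`
  have hc1 : 1 ≤ c + 1 := by linarith
  have hδ₁' : δ₁ ≤ η / 256 := by nlinarith
  have haη : ∀ ρ ∈ S, a η ρ ≠ 0 := fun ρ hρ h0 ↦ by
    have := (hsep ρ hρ).1; simp only [ha_def] at h0; rw [h0, norm_zero] at this; linarith
  have hbη : ∀ ρ ∈ S, b η ρ ≠ 0 := fun ρ hρ h0 ↦ by
    have := (hsep ρ hρ).2; simp only [hb_def] at h0; rw [h0, norm_zero] at this; linarith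
  have hη0 : (η : ℂ) ≠ 0 := by exact_mod_cast hη.ne'
  have hQη : Q η ≠ 0 := by
    rw [hQprod]
    refine mul_ne_zero (neg_ne_zero.mpr (pow_ne_zero 2 hη0)) (mul_ne_zero ?_ ?_)
    · exact Finset.prod_ne_zero_iff.mpr haη
    · exact Finset.prod_ne_zero_iff.mpr hbη
  -- the ratio `W = Q w / Q η = (w/η)² ∏ (a w/a η)(b w/b η)`
  set W : ℂ := Q w / Q η with hW_def
  have hQw : Q w = W * Q η := by rw [hW_def, div_mul_cancel₀ _ hQη]
  have hWeq : W = (w / η) ^ 2 * ∏ ρ ∈ S, (a w ρ / a η ρ * (b w ρ / b η ρ)) := by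
    rw [hW_def, hQprod, hQprod, Finset.prod_mul_distrib, Finset.prod_div_distrib,
      Finset.prod_div_distrib, div_pow]
    field_simp
  -- per-factor bounds
  have hfa : ∀ ρ ∈ S, ‖a w ρ / a η ρ - 1‖ ≤ δ₁ / δ := by
    intro ρ hρ
    rw [div_sub_one (haη ρ hρ)]
    have e : a w ρ - a η ρ = η - w := by simp only [ha_def]; ring
    rw [norm_div, e, norm_sub_rev]
    exact div_le_div₀ hδ₁ hw hδ (hsep ρ hρ).1
  have hfb : ∀ ρ ∈ S, ‖b w ρ / b η ρ - 1‖ ≤ δ₁ / δ := by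
    intro ρ hρ
    rw [div_sub_one (hbη ρ hρ)]
    have e : b w ρ - b η ρ = w - η := by simp only [hb_def]; ring
    rw [norm_div, e]
    exact div_le_div₀ hδ₁ hw hδ (hsep ρ hρ).2
  have hfs : ‖w / η - 1‖ ≤ δ₁ / η := by
    rw [div_sub_one hη0, norm_div, Complex.norm_real, Real.norm_eq_abs, abs_of_pos hη]
    exact div_le_div_of_nonneg_right hw hη.le
  -- `‖W − 1‖ ≤ M − 1`, `M = (1 + δ₁/η)² (1 + δ₁/δ)^{2|S|}`
  set x : ℝ := δ₁ / η with hx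
  set y : ℝ := δ₁ / δ with hy
  have hx0 : 0 ≤ x := div_nonneg hδ₁ hη.le
  have hy0 : 0 ≤ y := div_nonneg hδ₁ hδ.le
  have hprod : ‖∏ ρ ∈ S, (a w ρ / a η ρ * (b w ρ / b η ρ)) - 1‖ ≤
      ((1 + y) ^ 2) ^ S.card - 1 := by
    refine (norm_prod_sub_one_le S _).trans ?_
    rw [← Finset.prod_const]
    refine sub_le_sub_right (Finset.prod_le_prod (fun _ _ ↦ by positivity) fun ρ hρ ↦ ?_) 1
    have := norm_mul_sub_one_le (a w ρ / a η ρ) (b w ρ / b η ρ)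
    have h1 : 1 + ‖a w ρ / a η ρ - 1‖ ≤ 1 + y := by linarith [hfa ρ hρ]
    have h2 : 1 + ‖b w ρ / b η ρ - 1‖ ≤ 1 + y := by linarith [hfb ρ hρ]
    have h12 := mul_le_mul h1 h2 (by positivity) (by linarith)
    nlinarith
  have hsq : ‖(w / η) ^ 2 - 1‖ ≤ (1 + x) ^ 2 - 1 := by
    rw [sq]
    have := norm_mul_sub_one_le (w / η) (w / η)
    have h1 : 1 + ‖w / ↑η - 1‖ ≤ 1 + x := by linarith [hfs]
    have h11 := mul_le_mul h1 h1 (by positivity) (by linarith)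
    nlinarith
  set M : ℝ := (1 + x) ^ 2 * ((1 + y) ^ 2) ^ S.card with hM
  have hW1 : ‖W - 1‖ ≤ M - 1 := by
    rw [hWeq]
    have := norm_mul_sub_one_le ((w / η) ^ 2) (∏ ρ ∈ S, (a w ρ / a η ρ * (b w ρ / b η ρ)))
    have h1 : 1 + ‖(w / ↑η) ^ 2 - 1‖ ≤ (1 + x) ^ 2 := by linarith
    have h2 : 1 + ‖∏ ρ ∈ S, (a w ρ / a η ρ * (b w ρ / b η ρ)) - 1‖ ≤ ((1 + y) ^ 2) ^ S.card := by
      linarith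
    have h12 := mul_le_mul h1 h2 (by positivity) (by positivity)
    linarith
  -- `M ≤ e^{5/128} ≤ 128/123`
  have hx1 : x ≤ 1 / 256 := by
    rw [hx, div_le_iff₀ hη]; linarith
  have hy1 : 64 * (N + 1) * y ≤ 1 := by
    rw [hy, ← mul_div_assoc, div_le_one hδ]; exact hδ₁δ
  have hn : (S.card : ℝ) ≤ N := by exact_mod_cast hcard
  have hny : (S.card : ℝ) * (2 * y) ≤ 1 / 32 := by
    nlinarith [mul_le_mul_of_nonneg_right hn hy0]
  have hexp2 : ∀ z : ℝ, 0 ≤ z → (1 + z) ^ 2 ≤ Real.exp (2 * z) := by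
    intro z hz
    calc (1 + z) ^ 2 ≤ Real.exp z ^ 2 :=
          pow_le_pow_left₀ (by linarith) (by linarith [Real.add_one_le_exp z]) 2
      _ = Real.exp (2 * z) := by rw [← Real.exp_nat_mul]; norm_num
  have hMle : M ≤ 128 / 123 := by
    have e2 : ((1 + y) ^ 2) ^ S.card ≤ Real.exp (S.card * (2 * y)) :=
      calc ((1 + y) ^ 2) ^ S.card ≤ Real.exp (2 * y) ^ S.card :=
            pow_le_pow_left₀ (by positivity) (hexp2 y hy0) _
        _ = Real.exp (S.card * (2 * y)) := (Real.exp_nat_mul _ _).symm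
    have h1 : M ≤ Real.exp (2 * x) * Real.exp (S.card * (2 * y)) :=
      mul_le_mul (hexp2 x hx0) e2 (by positivity) (by positivity)
    rw [← Real.exp_add] at h1
    have h2 : Real.exp (2 * x + S.card * (2 * y)) ≤ Real.exp (5 / 128) :=
      Real.exp_le_exp.mpr (by linarith)
    have h3 : (123 / 128 : ℝ) ≤ Real.exp (-(5 / 128)) := by
      have := Real.add_one_le_exp (-(5 / 128 : ℝ)); linarith
    have h4 : Real.exp (5 / 128) * Real.exp (-(5 / 128)) = 1 := by
      rw [← Real.exp_add]; norm_num
    have h5 : Real.exp (5 / 128) * (123 / 128) ≤ 1 := by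
      calc Real.exp (5 / 128) * (123 / 128) ≤ Real.exp (5 / 128) * Real.exp (-(5 / 128)) :=
            mul_le_mul_of_nonneg_left h3 (Real.exp_nonneg _)
        _ = 1 := h4
    linarith
  -- the `F` part
  have hcδ : δ₁ * (c + 1) ≤ 1 := by nlinarith
  have hF : ‖F w - F η‖ ≤ 24 * (δ₁ * (c + 1)) * ‖F η‖ :=
    norm_bumpDipoleF_sub_le_rel hψ hsupp hψ0 hc hη.le hη2 hreg hcδ hw
  have hh : 24 * (δ₁ * (c + 1)) ≤ 3 / 64 := by nlinarith
  have hFn := norm_nonneg (F η)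
  have hFd : ‖F w - F η‖ ≤ 3 / 64 * ‖F η‖ := hF.trans (mul_le_mul_of_nonneg_right hh hFn)
  have hFw : ‖F w‖ ≤ (1 + 3 / 64) * ‖F η‖ := by
    have := norm_add_le (F w - F η) (F η)
    rw [sub_add_cancel] at this
    linarith
  -- assemble
  have hGw : clusterG ψ c γ₀ S w - clusterG ψ c γ₀ S η =
      Q η * ((W - 1) * F w + (F w - F η)) := by
    rw [hG, hG, hQw]; ring
  rw [hGw, hG η, norm_mul (Q η) ((W - 1) * F w + (F w - F η)), norm_mul (Q η) (F η)]
  have hn1 := norm_add_le ((W - 1) * F w) (F w - F η)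
  rw [norm_mul] at hn1
  have hW1' : ‖W - 1‖ ≤ 5 / 123 := by linarith
  have hWF : ‖W - 1‖ * ‖F w‖ ≤ 5 / 123 * ((1 + 3 / 64) * ‖F η‖) :=
    mul_le_mul hW1' hFw (norm_nonneg _) (by norm_num)
  have hinner : ‖(W - 1) * F w + (F w - F η)‖ ≤ ‖F η‖ / 7 := by linarith
  calc ‖Q η‖ * ‖(W - 1) * F w + (F w - F η)‖ ≤ ‖Q η‖ * (‖F η‖ / 7) :=
        mul_le_mul_of_nonneg_left hinner (norm_nonneg _)
    _ = ‖Q η‖ * ‖F η‖ / 7 := by ring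

/-! ## T37b: the un-dodged condition near the pair -/

/-- **T37b.**  For the cluster test `k = D₀ D_{clusterList S} h_c` (dodged members `S`,
`δ`-separated from the pair, `|S| ≤ N`), in the gain regime and with `256(c+1)δ₁ ≤ η ≤ ½`,
`64(N+1)δ₁ ≤ δ`: every `ρ` within `δ₁` of `½ + η + iγ₀` or of `½ − η + iγ₀` satisfies the
un-dodged condition `|ĝ(ρ)|² ≤ ½|ĝ(ρ) − ĝ(1 − ρ̄)|²` of T37a. -/
theorem undodged_condition_near_pair (hψ : ContDiff ℝ ∞ ψ) (hsupp : tsupport ψ ⊆ Icc (-1) 1)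
    (hψ0 : ∀ s, 0 ≤ ψ s) {η c δ δ₁ γ₀ : ℝ} {N : ℕ} {S : Finset ℂ} (hη : 0 < η)
    (hη2 : η ≤ 1 / 2) (hc : 0 ≤ c)
    (hreg : 2 * bumpLaplace ψ (-η) ≤ Real.exp (η * c) * bumpLaplace ψ η) (hδ : 0 < δ)
    (hcard : S.card ≤ N)
    (hsep : ∀ ρ ∈ S, δ ≤ ‖ρ - (1 / 2 + η + γ₀ * I)‖ ∧ δ ≤ ‖ρ - (1 / 2 - η + γ₀ * I)‖)
    (hδ₁ : 0 ≤ δ₁) (hδ₁η : 256 * (c + 1) * δ₁ ≤ η) (hδ₁δ : 64 * (N + 1) * δ₁ ≤ δ) {ρ : ℂ}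
    (hρ : ‖ρ - (1 / 2 + η + γ₀ * I)‖ ≤ δ₁ ∨ ‖ρ - (1 / 2 - η + γ₀ * I)‖ ≤ δ₁) :
    ‖weilMellin (fun t ↦ weilDodges (0 :: clusterList γ₀ S) (bumpDipole ψ c) t *
        cexp (-(γ₀ * I) * t)) ρ‖ ^ 2 ≤
      ‖weilMellin (fun t ↦ weilDodges (0 :: clusterList γ₀ S) (bumpDipole ψ c) t *
            cexp (-(γ₀ * I) * t)) ρ -
          weilMellin (fun t ↦ weilDodges (0 :: clusterList γ₀ S) (bumpDipole ψ c) t *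
            cexp (-(γ₀ * I) * t)) (1 - conj ρ)‖ ^ 2 / 2 := by
  rw [weilMellin_clusterTest_twist hψ hsupp hc γ₀ S ρ,
    weilMellin_clusterTest_twist_reflect hψ hsupp hc γ₀ S ρ, sub_neg_eq_add]
  have hpert : ∀ v : ℂ, ‖v - η‖ ≤ δ₁ →
      ‖clusterG ψ c γ₀ S v - clusterG ψ c γ₀ S η‖ ≤ 1 / 7 * ‖clusterG ψ c γ₀ S (η : ℂ)‖ :=
    fun v hv ↦ (norm_clusterG_sub_le hψ hsupp hψ0 hη hη2 hc hreg hδ hcard hsep hδ₁ hδ₁η hδ₁δ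
      hv).trans_eq (by ring)
  have hconj : ∀ v : ℂ, ‖conj v - η‖ = ‖v - η‖ := by
    intro v
    rw [← Complex.norm_conj (v - η), map_sub, Complex.conj_ofReal]
  rcases hρ with h0 | h1
  · have hu : ‖(ρ - γ₀ * I - 1 / 2) - η‖ ≤ δ₁ := by
      have e : ρ - γ₀ * I - 1 / 2 - η = ρ - (1 / 2 + η + γ₀ * I) := by ring
      rwa [e]
    exact sq_norm_le_half_sq_norm_add (hpert _ hu)
      (hpert (conj (ρ - γ₀ * I - 1 / 2)) (by rwa [hconj])) (by norm_num)
  · have hu : ‖-(ρ - γ₀ * I - 1 / 2) - η‖ ≤ δ₁ := by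
      have e : -(ρ - γ₀ * I - 1 / 2) - η = -(ρ - (1 / 2 - η + γ₀ * I)) := by ring
      rwa [e, norm_neg]
    have key := sq_norm_le_half_sq_norm_add (ε := 1 / 7) (hpert _ hu)
      (hpert (conj (-(ρ - γ₀ * I - 1 / 2))) (by rwa [hconj])) (by norm_num)
    rw [map_neg, clusterG_neg, clusterG_neg, norm_neg, ← neg_add, norm_neg] at key
    exact key

end Summit.RiemannHypothesis.RiemannHypothesis.Theorems
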